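import Mathlib.Analysis.InnerProductSpace.Spectrum
import Mathlib.Analysis.InnerProductSpace.Dual
import Mathlib.Analysis.Complex.Basic
import HarnessLib

/-!
# Unitary diagonalisation of a `J`-invariant symmetric real bilinear form

Let `W` be a finite-dimensional complex inner product space and `L : W × W → ℝ` a real-bilinear,
symmetric form which is invariant under the complex structure, `L(i a, i b) = L(a, b)` (the real
part of a Hermitian form; e.g. the Levi form `½ (D²w(a)(b) + D²w(i a)(i b))` of a real `C²` function,
`Literature/Geometry/Kaehler/DDcForm.lean`). Then **there is a unitary basis `u` of `W`
(orthonormal for the inner product) and real numbers `λᵢ` with `L(uᵢ, uⱼ) = λᵢ δᵢⱼ` and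
`L(uᵢ, i uⱼ) = 0`** (`exists_orthonormalBasis_levi_diag`): the Hermitian form
`h(a, b) = L(a, b) - i L(a, i b)` (`leviSesq`) is represented by a self-adjoint operator `T`,
`⟪T a, b⟫ = h(a, b)` (Mathlib's `continuousLinearMapOfBilin`), which is diagonalised by an
orthonormal eigenbasis (`LinearMap.IsSymmetric.eigenvectorBasis`). If moreover `L(a, a) ≥ 0` for
all `a` then `λᵢ ≥ 0`. Together with `Literature.Geometry.Kaehler.TwoForm.twoPow_apply_complexPairFrame`
this evaluates `(dd^c w)ᵖ` on the complex frame of a tangent complex `p`-plane as `p! ∏ 2λᵢ ≥ 0`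
[Chirka1989, §13.2]; [Demailly, Ch. III §1 (strongly positive forms)].

Definitions with bodies (`leviSesq`); theorems proved from Mathlib.

## References

* E. M. Chirka, *Complex Analytic Sets*, Kluwer 1989, §13.1–13.2 (Hermitian and fundamental forms)
  [Chirka1989].
* C. Voisin, *Hodge Theory and Complex Algebraic Geometry I*, §3.1.1 (Hermitian forms and their real
  parts) [VoisinHodgeI2002].
-/

open scoped InnerProductSpace ComplexConjugate
open Complex Module

noncomputable section

namespace Literature.Geometry.Kaehler

variable {W : Type*} [NormedAddCommGroup W] [InnerProductSpace ℂ W]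

/-! ### The Hermitian form `h(a, b) = L(a, b) - i L(a, i b)` of a `J`-invariant symmetric form -/

section Sesq

variable (L : W →L[ℝ] W →L[ℝ] ℝ)

/-- The complex-valued form `h(a, b) = L(a, b) - i L(a, i b)` attached to a real bilinear form `L`
(for `L` `J`-invariant this form is conjugate-linear in `a` and linear in `b`, and Hermitian when
`L` is moreover symmetric, with real part `L`). [cite: VoisinHodgeI2002, §3.1.1] -/
def leviSesqFun (a b : W) : ℂ := (L a b : ℂ) - I * (L a (I • b) : ℂ)

variable {L}

/-- `h` is additive in the second variable. [folklore] -/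
theorem leviSesqFun_add_right (a b b' : W) :
    leviSesqFun L a (b + b') = leviSesqFun L a b + leviSesqFun L a b' := by
  simp only [leviSesqFun, smul_add, map_add, ofReal_add]
  ring

/-- `h` is additive in the first variable. [folklore] -/
theorem leviSesqFun_add_left (a a' b : W) :
    leviSesqFun L (a + a') b = leviSesqFun L a b + leviSesqFun L a' b := by
  simp only [leviSesqFun, map_add, add_apply, ofReal_add]
  ring

/-- `h` is complex-linear in the second variable. [folklore] -/
theorem leviSesqFun_smul_right (c : ℂ) (a b : W) :
    leviSesqFun L a (c • b) = c * leviSesqFun L a b := by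
  -- decompose `c = x + i y` and use real-bilinearity and `L(a, i(i b)) = -L(a, b)`
  have hc : c • b = (c.re : ℂ) • b + (c.im : ℂ) • (I • b) := by
    conv_lhs => rw [← re_add_im c]
    rw [add_smul, mul_smul]
  have hII : I • (I • b) = -b := by rw [smul_smul, I_mul_I, neg_one_smul]
  have h1 : L a ((c.re : ℂ) • b) = c.re * L a b := by
    rw [Complex.coe_smul, map_smul, smul_eq_mul]
  have h2 : L a ((c.im : ℂ) • (I • b)) = c.im * L a (I • b) := by
    rw [Complex.coe_smul, map_smul, smul_eq_mul]
  have h3 : L a (I • ((c.re : ℂ) • b)) = c.re * L a (I • b) := by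
    rw [smul_comm, Complex.coe_smul, map_smul, smul_eq_mul]
  have h4 : L a (I • ((c.im : ℂ) • (I • b))) = -(c.im * L a b) := by
    rw [smul_comm, hII, Complex.coe_smul, map_smul, map_neg, smul_eq_mul, mul_neg]
  simp only [leviSesqFun, hc, map_add, smul_add, h1, h2, h3, h4, ofReal_add, ofReal_mul, ofReal_neg]
  conv_rhs => rw [← re_add_im c]
  ring_nf
  rw [I_sq]
  ring

/-- `h` is conjugate-linear in the first variable when `L` is `J`-invariant. [folklore] -/
theorem leviSesqFun_smul_left (hJ : ∀ a b, L (I • a) (I • b) = L a b)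
    (c : ℂ) (a b : W) : leviSesqFun L (c • a) b = conj c * leviSesqFun L a b := by
  have hc : c • a = (c.re : ℂ) • a + (c.im : ℂ) • (I • a) := by
    conv_lhs => rw [← re_add_im c]
    rw [add_smul, mul_smul]
  have hII : ∀ x : W, I • (I • x) = -x := fun x => by rw [smul_smul, I_mul_I, neg_one_smul]
  -- `L(i a, b) = -L(a, i b)` and `L(i a, i b) = L(a, b)`
  have hIa : L (I • a) b = -L a (I • b) := by
    have := hJ (I • a) b
    rw [hII] at this
    rw [← this, map_neg, neg_apply]
  have h1 : L ((c.re : ℂ) • a) b = c.re * L a b := by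
    rw [Complex.coe_smul, L.map_smul]; rfl
  have h2 : L ((c.im : ℂ) • (I • a)) b = -(c.im * L a (I • b)) := by
    rw [Complex.coe_smul, L.map_smul]
    show c.im * L (I • a) b = _
    rw [hIa, mul_neg]
  have h3 : L ((c.re : ℂ) • a) (I • b) = c.re * L a (I • b) := by
    rw [Complex.coe_smul, L.map_smul]; rfl
  have h4 : L ((c.im : ℂ) • (I • a)) (I • b) = c.im * L a b := by
    rw [Complex.coe_smul, L.map_smul, ← hJ a b]; rfl
  simp only [leviSesqFun, hc, map_add, add_apply, h1, h2, h3, h4, ofReal_add,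
    ofReal_mul, ofReal_neg]
  conv_rhs => rw [← re_add_im c, map_add, conj_ofReal, map_mul, conj_ofReal, conj_I]
  ring_nf
  rw [I_sq]
  ring

/-- `h` is Hermitian: `h(b, a) = conj h(a, b)`. [folklore] -/
theorem leviSesqFun_conj_symm (hsym : ∀ a b, L a b = L b a) (hJ : ∀ a b, L (I • a) (I • b) = L a b)
    (a b : W) : conj (leviSesqFun L a b) = leviSesqFun L b a := by
  have hII : I • (I • a) = -a := by rw [smul_smul, I_mul_I, neg_one_smul]
  have h1 : L b (I • a) = -L a (I • b) := by
    rw [hsym b (I • a)]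
    have := hJ (I • a) b
    rw [hII] at this
    rw [← this, map_neg, neg_apply]
  simp only [leviSesqFun, map_sub, map_mul, conj_ofReal, conj_I, h1, hsym b a, ofReal_neg]
  ring

/-- Norm bound `|h(a, b)| ≤ 2 ‖L‖ ‖a‖ ‖b‖`. [folklore] -/
theorem norm_leviSesqFun_le (a b : W) : ‖leviSesqFun L a b‖ ≤ 2 * ‖L‖ * ‖a‖ * ‖b‖ := by
  have h1 : ‖(L a b : ℂ)‖ ≤ ‖L‖ * ‖a‖ * ‖b‖ := by
    rw [norm_real]
    exact L.le_opNorm₂ a b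
  have h2 : ‖I * (L a (I • b) : ℂ)‖ ≤ ‖L‖ * ‖a‖ * ‖b‖ := by
    rw [norm_mul, norm_I, one_mul, norm_real]
    have := L.le_opNorm₂ a (I • b)
    rwa [norm_smul, norm_I, one_mul] at this
  calc ‖leviSesqFun L a b‖ ≤ ‖(L a b : ℂ)‖ + ‖I * (L a (I • b) : ℂ)‖ := norm_sub_le _ _
    _ ≤ ‖L‖ * ‖a‖ * ‖b‖ + ‖L‖ * ‖a‖ * ‖b‖ := add_le_add h1 h2
    _ = 2 * ‖L‖ * ‖a‖ * ‖b‖ := by ring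

variable (L) in
/-- The Hermitian form `h(a, b) = L(a, b) - i L(a, i b)` as a continuous sesquilinear map
(conjugate-linear in the first slot, linear in the second), for `L` `J`-invariant.
[cite: VoisinHodgeI2002, §3.1.1] -/
def leviSesq (hJ : ∀ a b, L (I • a) (I • b) = L a b) : W →L⋆[ℂ] W →L[ℂ] ℂ :=
  LinearMap.mkContinuous₂
    (LinearMap.mk₂'ₛₗ (starRingEnd ℂ) (RingHom.id ℂ) (fun a b => leviSesqFun L a b)
      (fun a a' b => leviSesqFun_add_left a a' b)
      (fun c a b => by rw [leviSesqFun_smul_left hJ, smul_eq_mul])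
      (fun a b b' => leviSesqFun_add_right a b b')
      (fun c a b => by rw [leviSesqFun_smul_right, RingHom.id_apply, smul_eq_mul]))
    (2 * ‖L‖) (fun a b => by
      simpa [mul_assoc] using norm_leviSesqFun_le (L := L) a b)

/-- Unfolding: `leviSesq L a b = L(a, b) - i L(a, i b)`. [folklore] -/
@[simp] theorem leviSesq_apply (hJ : ∀ a b, L (I • a) (I • b) = L a b)
    (a b : W) : leviSesq L hJ a b = (L a b : ℂ) - I * (L a (I • b) : ℂ) := rfl

/-- The real part of `h` is `L`. [folklore] -/
theorem re_leviSesq_apply (hJ : ∀ a b, L (I • a) (I • b) = L a b)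
    (a b : W) : (leviSesq L hJ a b).re = L a b := by
  simp

/-- The imaginary part of `h` is `-L(a, i b)`. [folklore] -/
theorem im_leviSesq_apply (hJ : ∀ a b, L (I • a) (I • b) = L a b)
    (a b : W) : (leviSesq L hJ a b).im = -L a (I • b) := by
  simp

end Sesq

/-! ### Diagonalisation by a unitary eigenbasis -/

section Diag

variable [FiniteDimensional ℂ W] {L : W →L[ℝ] W →L[ℝ] ℝ}

/-- **Unitary diagonalisation of a `J`-invariant symmetric form.** For a real-bilinear symmetric
`J`-invariant form `L` on a finite-dimensional complex inner product space `W` of dimension `n`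
there are an orthonormal (unitary) basis `u` of `W` and real numbers `λᵢ` with
`L(uᵢ, uⱼ) = λᵢ δᵢⱼ` and `L(uᵢ, i uⱼ) = 0` for all `i, j`; if `L(a, a) ≥ 0` for all `a` then all
`λᵢ ≥ 0`. (The self-adjoint operator `T` with `⟪T a, b⟫ = L(a,b) - i L(a, i b)` — Mathlib's
`continuousLinearMapOfBilin` — has an orthonormal eigenbasis, `LinearMap.IsSymmetric.eigenvectorBasis`.)
[cite: VoisinHodgeI2002, §3.1.3 Lemma 3.8 (proof)] -/
theorem exists_orthonormalBasis_levi_diag {n : ℕ} (hn : finrank ℂ W = n)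
    (hsym : ∀ a b, L a b = L b a) (hJ : ∀ a b, L (I • a) (I • b) = L a b) :
    ∃ (u : OrthonormalBasis (Fin n) ℂ W) (ev : Fin n → ℝ),
      (∀ i j, L (u i) (u j) = if i = j then ev i else 0) ∧
      (∀ i j, L (u i) (I • u j) = 0) ∧
      ((∀ a, 0 ≤ L a a) → ∀ i, 0 ≤ ev i) := by
  haveI : CompleteSpace W := FiniteDimensional.complete ℂ W
  set B := leviSesq L hJ with hB
  set T : W →L[ℂ] W := InnerProductSpace.continuousLinearMapOfBilin B with hT
  have hTB : ∀ a b, ⟪T a, b⟫_ℂ = B a b := InnerProductSpace.continuousLinearMapOfBilin_apply B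
  -- `T` is self-adjoint because `h` is Hermitian
  have hTsymm : (T : W →ₗ[ℂ] W).IsSymmetric := by
    intro a b
    change ⟪T a, b⟫_ℂ = ⟪a, T b⟫_ℂ
    rw [hTB, ← inner_conj_symm, hTB]
    exact (leviSesqFun_conj_symm hsym hJ b a).symm
  set u := hTsymm.eigenvectorBasis hn with hu
  set ev := hTsymm.eigenvalues hn with hev
  have hdiag : ∀ i j, B (u i) (u j) = if i = j then (ev i : ℂ) else 0 := by
    intro i j
    rw [← hTB]
    change ⟪(T : W →ₗ[ℂ] W) (u i), u j⟫_ℂ = _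
    rw [hu, hTsymm.apply_eigenvectorBasis hn i, inner_smul_left, RCLike.conj_ofReal,
      orthonormal_iff_ite.1 (hTsymm.eigenvectorBasis hn).orthonormal i j]
    split_ifs <;> simp [hev]
  refine ⟨u, ev, fun i j => ?_, fun i j => ?_, fun hpos i => ?_⟩
  · have h := congrArg Complex.re (hdiag i j)
    rw [hB, re_leviSesq_apply] at h
    rw [h]
    split_ifs <;> simp
  · have h := congrArg Complex.im (hdiag i j)
    rw [hB, im_leviSesq_apply] at h
    have : L (u i) (I • u j) = -(if i = j then (ev i : ℂ) else 0).im := by rw [← h, neg_neg]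
    rw [this]
    split_ifs <;> simp
  · have h := congrArg Complex.re (hdiag i i)
    rw [hB, re_leviSesq_apply, if_pos rfl, ofReal_re] at h
    rw [← h]
    exact hpos (u i)

end Diag


end Literature.Geometry.Kaehler

end
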